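import Summits.CriticalPhenomena.PercolationContinuityZ3.Theorems.PercNearOneGluingNoHeavyQuantTLBClosureHeavy
import Summits.CriticalPhenomena.PercolationContinuityZ3.Theorems.PercNearOneGluingNoHeavyQuantGatedConvSplit
import HarnessLib

/-!
# QUANT lane R8, the light half read through the heavy theorem: LIGHT GATES OVER HEAVY UNITS — what the heavy invariant `InvH`
# does and does not carry through a light gate (one unit: theorem; dominated pair: theorem; general pair: exact counterexample)

builds on p205010 (kernel theorem, internal audit signed; external expert review pending)

Statement + support file (`--supports stmt-CriticalPhenomena-4575`), QUANT lane LEAD seat prim-quant-lead (gen 40), rung R8 of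
`run/shared/lean/prim/quant/LADDER.md`; memo `run/shared/lean/prim/quant/prim-quant-lead-g40/LEAD-NOTES-G40.md` N3–N5, lane verdict V382.
No definitions, no `@[conjecture]`; theorems only; standard axioms, no sorries.  Continues `…QuantTLBClosureHeavy` (lead g37: `LawDec.InvH`, the heavy
node `LawDec.TLBGateConvClosedHeavy` — a theorem in combined scratch by three countersigned routes, V373 — and `treeBuilt_invH`).

THE PICTURE (LEAD-NOTES-G40 N3).  In a rooted gate forest put `x_v :=` (least relay marginal below `v`) / `P(v reached)`, the floor of the
inner forest of `v` given `v` is reached; `x_v` is non-decreasing downwards and `= 1` at leaves, so the vertices with `x_v ≥ 1/2` form a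
down-closed union of subtrees (HEAVY UNITS, to which the heavy theorem applies: their inner laws satisfy `InvH`) and the rest is the LIGHT
SKELETON.  Conditionally on the skeleton's gates the count is (sure relays) + an independent sum of active heavy units, so every light forest
law is an explicit product-measure mixture of heavy laws.  The first light family beyond the heavy half is therefore ONE LIGHT LAYER:
independent light gates `q_t` over heavy inner forests `H_t` (floors `y_t ≥ 1/2`, so the relay floor is `x = min_t q_t·y_t`, possibly `< 1/2`).
QUESTION (lane, since V373): can the heavy theorem serve as a BLACK BOX for that family, i.e. does the row follow for two units ABSTRACTED
to `InvH` laws (generalising `Quant.IndepBlob.far_indepBlob`, units = sure blobs)?  ANSWER (this file): for ONE unit yes (a theorem), for a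
pair yes when the partner's gated floor dominates (a theorem modulo the heavy node), and NO in general — an exact two-unit witness in which
all hypotheses hold and the row fails by `9/1000`.  So the light half cannot be separated from the heavy half through two-layer bounds; the
information a light gate needs about a heavy sub-forest is DEC-type (its gated law at the light floor), i.e. the all-depth lines of record
(`SingleGateConvClosed`, `GatedConvEmptyFree`).

* NOT TYPED, REFUTED FOR ABSTRACT UNITS (recorded here so it is not re-proposed): the two-layer form 'same binder ⟹
  `TLB (x/(1−x)) (q₁T₁+q₂T₂) (M₁+M₂) (gate μ₁ q₁ ∗ gate μ₂ q₂)`' — already ONE gated `InvH` unit can violate the light-rate two-layer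
  bound at a LOWER layer `d < j` (kit j231391: 20 / 36 000, all single-unit, e.g. `μ = {1: .381, 3: .153, 10: .466}`, `y = .55`, `τ = 5.5`,
  `q = .73`, `d = 1`: `u·P(≤1) = .368 > .340 = P(≥ 4)`; such `μ` is `InvH` but not a tree law — `μ 0 = 0` with all marginals `.55` is
  impossible on a forest); the ROW (`d = j`) survives every test.  So a proof of LGH(2) from `InvH` must aim at the row, not at light-rate TLB.
* `LawDec.lightGatedHeavyUnit_row` — THE ONE-UNIT CASE IS A THEOREM: `x ≤ q·y`, `InvH y M μ`, `2j < q·T` ⟹ `x ≤ Σ_{h>j} gate μ q h`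
  (`InvH` at the trivial gate is the ungated two-layer family, whose `d = j` row is `y ≤ μ{>j}`; a gate scales tails by `q`).
* `LawDec.lightGatedHeavyPair_of_dominated` — the pair case when the partner's gated floor dominates the first unit's inner floor
  (`y₁ ≤ q₂y₂`): a THEOREM modulo the heavy node (`invH_gate` / `invH_mono` / `invH_conv` + the affine split `lgh_lconv_gate_left`).
* `LawDec.invH_lightGatedPair_row_fails` — the general pair statement for abstract `InvH` units is FALSE: explicit rational witness
  (`μ₁ = {1: 2/5, 2: 1/5, 8: 2/5}`, `μ₂ = {0: 1/2, 1: 1/2}`, `y = 1/2`, `q = 9/10`, `j = 2`, `x = 9/20`, tail `441/1000`).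

HISTORY / EVIDENCE (lead g40 kit jobs attached to stmt-4575, alternating HiGHS LPs over the unit laws): random and hill-climbing adversaries
(j231264, j231299, j231390, j231393, j231472, j231473: ≈ 87 000 abstract instances) found NO violation and a minimum slack of exactly 0 at the
row's equality family, so the pair statement was typed as a node (V382, p389957); a STRUCTURED-CORNER adversary written the same hour
(j231748, j231791: TA-tight units with mean at the row threshold `2j`, tiny partners, gates at the mean threshold) found the thin junk family
above (37 corners, margins ≤ 10⁻²) and p389957 was WITHDRAWN before verification (V383).  LESSON (= V358's): random + climbing adversaries do not
see margin-10⁻² corners; enumerate the structured corners.  HONEST STATUS: nothing here is a published result; the RATE class log\* and the honest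
sentence of `run/shared/lean/prim/quant/README.md` are unchanged.  Nearest prior art: as for `far_indepBlob` (small-ball / anti-concentration bounds for Bernoulli-weighted sums: Paley–Zygmund,
Feige 2006; none gate-wise) — [this work].  The gluing rows served [cite: KozmaNitzan2024, Conjecture 3 (p. 15)]; product measure
[cite: Grimmett1999, §1.3 p. 10].
-/

noncomputable section

namespace Summit.CriticalPhenomena.PercolationContinuityZ3.Theorems

namespace Quant

open Finset

namespace LawDec

/-- **THE ONE-UNIT CASE OF LGH IS A THEOREM**: a heavy unit (`InvH y M μ`, mass one, nonnegative, `1/2 ≤ y < 1`) hung under any gate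
`0 < q ≤ 1` satisfies the far-relay row at every floor `x ≤ q·y`: `2j < q·T ⟹ x ≤ Σ_{h > j} gate μ q h`.  (`InvH` at the trivial gate
is the ungated two-layer family, whose `d = j` row gives `y ≤ μ{> j}` by `tail_ge_of_tlb`; the gate multiplies the tail by `q`.) [this work] -/
theorem lightGatedHeavyUnit_row {x q y : ℝ} {M : ℕ} {μ : ℕ → ℝ} (hxq : x ≤ q * y) (hy : 1 / 2 ≤ y) (hy1 : y < 1)
    (hq0 : 0 < q) (hq1 : q ≤ 1) (hμ0 : ∀ h, 0 ≤ μ h) (hμ1 : ∑ h ∈ Finset.range (M + 1), μ h = 1) (hI : InvH y M μ)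
    (j : ℕ) (hdom : (2 * j : ℝ) < q * ∑ h ∈ Finset.range (M + 1), (h : ℝ) * μ h) :
    x ≤ ∑ h ∈ Finset.Ico (j + 1) (M + 1), gate μ q h := by
  have hy0 : 0 < y := by linarith
  have h1 := hI 1 one_pos le_rfl (by linarith)
  rw [gate_one, one_mul, one_mul] at h1
  have hT0 : 0 ≤ ∑ h ∈ Finset.range (M + 1), (h : ℝ) * μ h :=
    Finset.sum_nonneg fun h _ => mul_nonneg (Nat.cast_nonneg h) (hμ0 h)
  have hdom' : (2 * j : ℝ) < ∑ h ∈ Finset.range (M + 1), (h : ℝ) * μ h := by nlinarith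
  have htail : y ≤ ∑ h ∈ Finset.Ico (j + 1) (M + 1), μ h := tail_ge_of_tlb hy0 hy1 hμ0 hμ1 h1 j hdom'
  have htg : ∑ h ∈ Finset.Ico (j + 1) (M + 1), gate μ q h = q * ∑ h ∈ Finset.Ico (j + 1) (M + 1), μ h := by
    rw [Finset.mul_sum]
    refine Finset.sum_congr rfl fun h hh => ?_
    rw [Finset.mem_Ico] at hh
    simp only [gate]
    rw [if_neg (by omega), add_zero]
  rw [htg]
  calc x ≤ q * y := hxq
    _ ≤ q * ∑ h ∈ Finset.Ico (j + 1) (M + 1), μ h := mul_le_mul_of_nonneg_left htail hq0.le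

/-- a gated law vanishes where the law does, above the top. [this work] -/
theorem lgh_gate_eq_zero {μ : ℕ → ℝ} {M : ℕ} (hμM : ∀ h, M < h → μ h = 0) (q : ℝ) (h : ℕ) (hh : M < h) :
    gate μ q h = 0 := by
  simp only [gate]
  rw [hμM h hh, if_neg (by omega)]; ring

/-- **convolution is affine in a gated left factor**: `(gate μ₁ q) ∗ ν = q·(μ₁ ∗ ν) + (1−q)·ν` pointwise (`ν` vanishing above its top).
[this work] -/
theorem lgh_lconv_gate_left (M₁ M₂ : ℕ) (μ₁ ν : ℕ → ℝ) (q : ℝ) (hνM : ∀ h, M₂ < h → ν h = 0) (h : ℕ) :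
    lconv M₁ M₂ (gate μ₁ q) ν h = q * lconv M₁ M₂ μ₁ ν h + (1 - q) * ν h := by
  have e : gate μ₁ q = fun k => q * μ₁ k + (1 - q) * (if k = 0 then (1 : ℝ) else 0) := by
    funext k; exact gate_apply μ₁ q k
  rw [e, lconv_comm, lconv_lin_right, ← lconv_comm M₁ M₂ μ₁ ν, ← lconv_comm M₁ M₂ (fun i => if i = 0 then (1 : ℝ) else 0) ν,
    lconv_delta_left M₁ M₂ ν hνM h]

/-- **LGH(2), THE DOMINATED CASE, IS A THEOREM (modulo the heavy node).**  If the partner's GATED floor is heavy and dominates the first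
unit's inner floor — `y₁ ≤ q₂·y₂` (so `q₂y₂ ≥ 1/2`; `y₂ < 1`, a sure blob being an `InvH` unit at every floor `< 1`) — then the pair satisfies the row at every floor `x ≤ q₁·y₁`: indeed
`P(ξ₁N₁ + ξ₂N₂ > j) ≥ q₁·P(N₁ + ξ₂N₂ > j)` and `N₁ + ξ₂N₂` is a HEAVY law at floor `y₁` (the gated partner is `InvH` at `q₂y₂ ≥ y₁`,
convolution by `TLBGateConvClosedHeavy`), whose `d = j` two-layer row gives `P(N₁ + ξ₂N₂ > j) ≥ y₁` as `2j < q₁T₁ + q₂T₂ ≤ T₁ + q₂T₂`.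
The genuinely light case (`q₂y₂ < max(1/2, y₁)` and symmetrically) is FALSE for abstract units (`invH_lightGatedPair_row_fails`). [this work] -/
theorem lightGatedHeavyPair_of_dominated (hC : TLBGateConvClosedHeavy)
    {x q₁ q₂ y₁ y₂ : ℝ} {M₁ M₂ : ℕ} {μ₁ μ₂ : ℕ → ℝ}
    (hxq : x ≤ q₁ * y₁) (hy₁ : 1 / 2 ≤ y₁) (hy₁1 : y₁ < 1) (hy₂1 : y₂ < 1)
    (hq₁0 : 0 < q₁) (hq₁1 : q₁ ≤ 1) (hq₂0 : 0 < q₂) (hq₂1 : q₂ ≤ 1)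
    (hdomfloor : y₁ ≤ q₂ * y₂)
    (n1 : ∀ h, 0 ≤ μ₁ h) (z1 : ∀ h, M₁ < h → μ₁ h = 0) (s1 : ∑ h ∈ Finset.range (M₁ + 1), μ₁ h = 1)
    (t1 : y₁ * (M₁ : ℝ) ≤ ∑ h ∈ Finset.range (M₁ + 1), (h : ℝ) * μ₁ h)
    (n2 : ∀ h, 0 ≤ μ₂ h) (z2 : ∀ h, M₂ < h → μ₂ h = 0) (s2 : ∑ h ∈ Finset.range (M₂ + 1), μ₂ h = 1)
    (t2 : y₂ * (M₂ : ℝ) ≤ ∑ h ∈ Finset.range (M₂ + 1), (h : ℝ) * μ₂ h)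
    (hI₁ : InvH y₁ M₁ μ₁) (hI₂ : InvH y₂ M₂ μ₂) (j : ℕ)
    (hdom : (2 * j : ℝ) < q₁ * (∑ h ∈ Finset.range (M₁ + 1), (h : ℝ) * μ₁ h) + q₂ * (∑ h ∈ Finset.range (M₂ + 1), (h : ℝ) * μ₂ h)) :
    x ≤ ∑ h ∈ Finset.Ico (j + 1) (M₁ + M₂ + 1), lconv M₁ M₂ (gate μ₁ q₁) (gate μ₂ q₂) h := by
  have hy₁0 : 0 < y₁ := by linarith
  set ν : ℕ → ℝ := gate μ₂ q₂ with hν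
  set T₁ : ℝ := ∑ h ∈ Finset.range (M₁ + 1), (h : ℝ) * μ₁ h with hT₁
  set T₂ : ℝ := ∑ h ∈ Finset.range (M₂ + 1), (h : ℝ) * μ₂ h with hT₂
  have hT₁0 : 0 ≤ T₁ := Finset.sum_nonneg fun h _ => mul_nonneg (Nat.cast_nonneg h) (n1 h)
  -- the gated partner as a heavy law at floor `y₁`
  have nν : ∀ h, 0 ≤ ν h := fun h => by
    rw [hν]
    simp only [gate]
    split_ifs <;> nlinarith [n2 h, hq₂0.le, hq₂1]
  have zν : ∀ h, M₂ < h → ν h = 0 := fun h hh => lgh_gate_eq_zero z2 q₂ h hh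
  have sν : ∑ h ∈ Finset.range (M₂ + 1), ν h = 1 := sum_gate μ₂ q₂ M₂ s2
  have mν : ∑ h ∈ Finset.range (M₂ + 1), (h : ℝ) * ν h = q₂ * T₂ := sum_mul_gate μ₂ q₂ M₂
  have hq₂y₂1 : q₂ * y₂ < 1 := by nlinarith
  have hIν : InvH y₁ M₂ ν := invH_mono nν (invH_gate hI₂ q₂ hq₂0 hq₂1) hy₁0.le hdomfloor hq₂y₂1
  have tν : y₁ * (M₂ : ℝ) ≤ ∑ h ∈ Finset.range (M₂ + 1), (h : ℝ) * ν h := by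
    rw [mν]
    have : y₁ * (M₂ : ℝ) ≤ q₂ * y₂ * (M₂ : ℝ) := mul_le_mul_of_nonneg_right hdomfloor (Nat.cast_nonneg M₂)
    nlinarith [mul_le_mul_of_nonneg_left t2 hq₂0.le]
  -- heavy convolution at floor `y₁`, then its `d = j` row
  have hconv : InvH y₁ (M₁ + M₂) (lconv M₁ M₂ μ₁ ν) := invH_conv hC hy₁0 hy₁1 n1 z1 s1 t1 nν zν sν tν hI₁ hIν
  have h1 := hconv 1 one_pos le_rfl (by linarith)
  rw [gate_one, one_mul, one_mul] at h1
  have sL : ∑ h ∈ Finset.range (M₁ + M₂ + 1), lconv M₁ M₂ μ₁ ν h = 1 := sum_lconv M₁ M₂ μ₁ ν s1 sν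
  have nL : ∀ h, 0 ≤ lconv M₁ M₂ μ₁ ν h := lconv_nonneg M₁ M₂ μ₁ ν n1 nν
  have mL : ∑ h ∈ Finset.range (M₁ + M₂ + 1), (h : ℝ) * lconv M₁ M₂ μ₁ ν h = T₁ + q₂ * T₂ := by
    rw [sum_mul_lconv M₁ M₂ μ₁ ν s1 sν, mν]
  have hdom' : (2 * j : ℝ) < ∑ h ∈ Finset.range (M₁ + M₂ + 1), (h : ℝ) * lconv M₁ M₂ μ₁ ν h := by
    rw [mL]; nlinarith
  have htail : y₁ ≤ ∑ h ∈ Finset.Ico (j + 1) (M₁ + M₂ + 1), lconv M₁ M₂ μ₁ ν h :=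
    tail_ge_of_tlb hy₁0 hy₁1 nL sL h1 j hdom'
  -- `(gate μ₁ q₁) ∗ ν ≥ q₁ · (μ₁ ∗ ν)` on the positive range
  have hsplit : ∑ h ∈ Finset.Ico (j + 1) (M₁ + M₂ + 1), lconv M₁ M₂ (gate μ₁ q₁) ν h
      = q₁ * ∑ h ∈ Finset.Ico (j + 1) (M₁ + M₂ + 1), lconv M₁ M₂ μ₁ ν h
        + (1 - q₁) * ∑ h ∈ Finset.Ico (j + 1) (M₁ + M₂ + 1), ν h := by
    rw [Finset.mul_sum, Finset.mul_sum, ← Finset.sum_add_distrib]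
    exact Finset.sum_congr rfl fun h _ => lgh_lconv_gate_left M₁ M₂ μ₁ ν q₁ zν h
  have hν0 : 0 ≤ ∑ h ∈ Finset.Ico (j + 1) (M₁ + M₂ + 1), ν h := Finset.sum_nonneg fun h _ => nν h
  rw [hsplit]
  calc x ≤ q₁ * y₁ := hxq
    _ ≤ q₁ * ∑ h ∈ Finset.Ico (j + 1) (M₁ + M₂ + 1), lconv M₁ M₂ μ₁ ν h := mul_le_mul_of_nonneg_left htail hq₁0.le
    _ ≤ q₁ * ∑ h ∈ Finset.Ico (j + 1) (M₁ + M₂ + 1), lconv M₁ M₂ μ₁ ν h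
        + (1 - q₁) * ∑ h ∈ Finset.Ico (j + 1) (M₁ + M₂ + 1), ν h := by nlinarith

/-- **THE HEAVY INVARIANT IS NOT A JUNK-FREE INTERFACE FOR LIGHT GATES (lead g40, V383; exact witness).**  There are two
laws `μ₁ = {1: 2/5, 2: 1/5, 8: 2/5}` (`M₁ = 8`, mean `4`, floor `y = 1/2`: top-affordable with equality and `InvH` — all its two-layer
bounds hold, the `d = 1` row with equality) and `μ₂ = {0: 1/2, 1: 1/2}` (`M₂ = 1`, mean `1/2`, `InvH (1/2)`), a common gate
`q = 9/10` and the floor `x = q·y = 9/20`, such that at layer `j = 2` the gated means sum to `81/20 > 4 = 2j` but the independent sum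
`ξ₁N₁ + ξ₂N₂` has `P(· > 2) = 441/1000 < 9/20`.  So 'light gates over `InvH` units satisfy the far-relay row' (the LGH(2) node of V382,
withdrawn p389957) is FALSE for abstract units: `μ₁` is not a tree law (`μ₁ 0 = 0` with eight relays of marginal `1/2` is impossible on a
forest; every tree law with these parameters has `P(N > 2) ≥ 1/2` in the censuses), and the information a light gate needs about a heavy
sub-forest exceeds its two-layer bounds (kit j231748 / j231791: the junk family is 'TA-tight unit with mean ≤ 2j, mass at low values and
one top atom, tiny partner, gates at the mean threshold', margins ≤ 10⁻²; neither closed rows nor closed two-layer bounds remove it). [this work] -/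
theorem invH_lightGatedPair_row_fails :
    ∃ (x q y : ℝ) (M₁ M₂ j : ℕ) (μ₁ μ₂ : ℕ → ℝ),
      0 < x ∧ x ≤ q * y ∧ 1 / 2 ≤ y ∧ y < 1 ∧ 0 < q ∧ q ≤ 1 ∧
      (∀ h, 0 ≤ μ₁ h) ∧ (∀ h, M₁ < h → μ₁ h = 0) ∧ (∑ h ∈ Finset.range (M₁ + 1), μ₁ h = 1) ∧
      y * (M₁ : ℝ) ≤ ∑ h ∈ Finset.range (M₁ + 1), (h : ℝ) * μ₁ h ∧
      (∀ h, 0 ≤ μ₂ h) ∧ (∀ h, M₂ < h → μ₂ h = 0) ∧ (∑ h ∈ Finset.range (M₂ + 1), μ₂ h = 1) ∧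
      y * (M₂ : ℝ) ≤ ∑ h ∈ Finset.range (M₂ + 1), (h : ℝ) * μ₂ h ∧
      InvH y M₁ μ₁ ∧ InvH y M₂ μ₂ ∧
      (2 * j : ℝ) < q * (∑ h ∈ Finset.range (M₁ + 1), (h : ℝ) * μ₁ h) + q * (∑ h ∈ Finset.range (M₂ + 1), (h : ℝ) * μ₂ h) ∧
      ∑ h ∈ Finset.Ico (j + 1) (M₁ + M₂ + 1), lconv M₁ M₂ (gate μ₁ q) (gate μ₂ q) h < x := by
  refine ⟨9 / 20, 9 / 10, 1 / 2, 8, 1, 2,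
    fun h => if h = 1 then 2 / 5 else if h = 2 then 1 / 5 else if h = 8 then 2 / 5 else 0,
    fun h => if h = 0 then 1 / 2 else if h = 1 then 1 / 2 else 0,
    by norm_num, by norm_num, by norm_num, by norm_num, by norm_num, by norm_num,
    fun h => by dsimp only; split_ifs <;> norm_num, fun h hh => ?_, ?_, ?_, fun h => by dsimp only; split_ifs <;> norm_num, fun h hh => ?_, ?_, ?_,
    ?_, ?_, ?_, ?_⟩
  · have h1 : h ≠ 1 := by omega
    have h2 : h ≠ 2 := by omega
    have h8 : h ≠ 8 := by omega
    simp [h1, h2, h8]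
  · norm_num [Finset.sum_range_succ]
  · norm_num [Finset.sum_range_succ]
  · have h0 : h ≠ 0 := by omega
    have h1 : h ≠ 1 := by omega
    simp [h0, h1]
  · norm_num [Finset.sum_range_succ]
  · norm_num [Finset.sum_range_succ]
  · -- `InvH (1/2) 8 μ₁`: only the trivial gate qualifies; its two-layer family holds (row `d = 1` with equality)
    intro q' hq0 hq1 hh
    have hq : q' = 1 := le_antisymm hq1 (by linarith)
    subst hq
    rw [gate_one]
    intro d hd
    have hT : ∑ h ∈ Finset.range (8 + 1), (h : ℝ) * (if h = 1 then (2 : ℝ) / 5 else if h = 2 then 1 / 5 else if h = 8 then 2 / 5 else 0) = 4 := by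
      norm_num [Finset.sum_range_succ]
    rw [one_mul, hT] at hd ⊢
    have hd1 : d ≤ 1 := by
      have : (d : ℝ) < 2 := by linarith
      exact_mod_cast Nat.lt_succ_iff.mp (by exact_mod_cast this : d < 2)
    interval_cases d <;> norm_num [Finset.sum_range_succ]
  · -- `InvH (1/2) 1 μ₂`
    intro q' hq0 hq1 hh
    have hq : q' = 1 := le_antisymm hq1 (by linarith)
    subst hq
    rw [gate_one]
    intro d hd
    have hT : ∑ h ∈ Finset.range (1 + 1), (h : ℝ) * (if h = 0 then (1 : ℝ) / 2 else if h = 1 then 1 / 2 else 0) = 1 / 2 := by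
      norm_num [Finset.sum_range_succ]
    rw [one_mul, hT] at hd ⊢
    have hd0 : d = 0 := by
      have : (d : ℝ) < 1 := by linarith
      exact_mod_cast Nat.lt_one_iff.mp (by exact_mod_cast this : d < 1)
    subst hd0
    norm_num [Finset.sum_range_succ]
  · norm_num [Finset.sum_range_succ]
  · norm_num [lconv, gate, Finset.sum_range_succ, Finset.sum_Ico_succ_top]

end LawDec

end Quant

end Summit.CriticalPhenomena.PercolationContinuityZ3.Theorems
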